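import Summits.AtomisticToContinuum.FouriersLaw.Theorems.BondHeatUncertaintySubdiffusiveBondHeatJunctionRatioLadder

/-!
# `SubOhmicBootstrap` and the 11071 nodes of the ratio ladder — PART (b) of `…JunctionRatioLadder`

Support file for stmt-AtomisticToContinuum-11071 (`BondHeatUncertainty.BoundedResponse` ⟺ `OhmicFloor`: `E_N(T) ≤ C₁/N`), decomposition
cell `decomp-a2c`, lens-1 (grading / quantitative ladder), gen 58 — file (13), PART (b) (SPLIT at gen 60 under the 400-line cap of
lean/CONVENTIONS.md §32, critic row 802; imports PART (a) `…JunctionRatioLadder` = §A kernel, §B `SeriesRatioLaw`/`AsymptoticSeriesLaw` and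
the exponent dictionary, §C necessity `asymptoticSeriesLaw_of_fouriersLaw`).  The body below (§D, §E) is byte-for-byte the gen-58 text; the
thesis, grading and calibration are stated in PART (a)'s docstring.  Conjunct of record N_F = `FouriersLaw` (residual 11071 ∧ 9121).

Contents.  §D `SubOhmicBootstrap` (per `T`: `(∀ s < 1, E_N ≤ C_s/N^s eventually) ⟹ E_N ≤ C₁/N eventually`) — the weakest typed bootstrap of
the lineage: `subOhmicBootstrap_of_boundedResponse` (11071-NECESSARY), `exponentFloor_one_of_subOhmicBootstrap`, the NODE OF RECORD
`boundedResponse_of_asymptoticSeriesLaw_of_subOhmicBootstrap` : `AsymptoticSeriesLaw → SubOhmicBootstrap → BoundedResponse` (critic row 785),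
its doors `subOhmicBootstrap_of_bufferedJunctionLaw`, `subOhmicBootstrap_of_noAnomalousChannel`; §E the mechanism nodes
`SeriesRatioLaw ρ ∧ BufferedJunctionLaw ⟹ 11071` (`ρ > 1/2`), `AsymptoticSeriesLaw ∧ BufferedJunctionLaw / LocalityPassivityLaw ⟹ 11071`, the graded
`SeriesRatioLaw ρ ∧ BufferedJunctionLawPow θ ⟹ 11071` (`2^θ < 2ρ`), `AsymptoticSeriesLaw ∧ BufferedJunctionLawPow θ / JunctionLaw θ ⟹ 11071` (every
`0 ≤ θ < 1`), and `pieces_of_fouriersLaw` (`FouriersLaw ∧ 11071 ⟹ AsymptoticSeriesLaw ∧ SubOhmicBootstrap`: both pieces necessary).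
TAGS (lens-1 convention).  `SubOhmicBootstrap`: WEAKER (11071-necessary; `<` `NoAnomalousChannel` 28285; `<` every `ExponentBootstrap a`
pointwise) · UNDECIDED · IDEA-NEEDED (attack only via its feeders `BufferedJunctionLaw ⟸ LocalityPassivityLaw` / 28285, never at sequence
level: `N/log N`, file (14)).  `BufferedJunctionLaw`: UNDECIDED, not necessary.  No `sorry`; standard axioms; nothing here closes an item.
-/

noncomputable section

open MeasureTheory Filter Topology Set
open scoped BigOperators

namespace Summit.AtomisticToContinuum.FouriersLaw.Theorems.SubdiffusiveBondHeat

namespace EscapeGrading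

open Literature.MathematicalPhysics.KineticTheory.HeatConduction
open Summit.AtomisticToContinuum.FouriersLaw.Theses.BondHeatUncertainty (BoundedResponse NonBallistic)
open Summit.AtomisticToContinuum.FouriersLaw.Theses.ChannelExclusionTauberian (NoBallisticChannel NoAnomalousChannel)

/-! ## D. The last epsilon: `SubOhmicBootstrap`, the weakest typed bootstrap -/

/-- **Sub-Ohmic bootstrap** (per temperature): if `E_N(T) ≤ C_s/N^s` eventually for EVERY `s < 1`, then `E_N(T) ≤ C₁/N` eventually —
«no logarithmic anomaly»: once all power-law anomalies are excluded, only slowly varying corrections (`E_N ≍ log N / N`) remain to be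
excluded.  NECESSARY (implied by 11071: `subOhmicBootstrap_of_boundedResponse`) · STRICTLY WEAKER than `NoAnomalousChannel` 28285
(`subOhmicBootstrap_of_noAnomalousChannel`: hypothesis `E_N → 0` only) and than every graded bootstrap `B(a)`, `a < 1`, pointwise · implied by
`BufferedJunctionLaw` (`subOhmicBootstrap_of_bufferedJunctionLaw`) · UNDECIDED · IDEA-NEEDED (integrability of the Green–Kubo tail at the
margin; no owner) · separated from 11071 by the harmonic member (hypothesis false there) and at sequence level by `E_N = log N/N`. [piece · rung] -/
def SubOhmicBootstrap : Prop :=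
  ∀ ω₂ lam β γ : ℝ, 0 < ω₂ → 0 < lam → 0 < β → 0 < γ → ∀ T : ℝ, 0 < T →
    (∀ s : ℝ, s < 1 → ∃ C : ℝ, ∃ N₀ : ℕ, ∀ N : ℕ, N₀ ≤ N → escapeDeficit ω₂ lam β γ T N ≤ C / (N : ℝ) ^ s) →
      ∃ C₁ : ℝ, ∃ N₀ : ℕ, ∀ N : ℕ, N₀ ≤ N → escapeDeficit ω₂ lam β γ T N ≤ C₁ / (N : ℝ)

/-- 11071 ⟹ `SubOhmicBootstrap` (the conclusion is the Ohmic floor). [folklore] -/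
theorem subOhmicBootstrap_of_boundedResponse (h : BoundedResponse) : SubOhmicBootstrap :=
  fun ω₂ lam β γ hω hl hβ hγ T hT _ => (ohmicFloor_iff_boundedResponse.2 h) ω₂ lam β γ hω hl hβ hγ T hT

/-- `SubOhmicBootstrap` gives the global bootstrap `⋀_{s<1} F(s) ⟹ F(1)`. [folklore] -/
theorem exponentFloor_one_of_subOhmicBootstrap (hB : SubOhmicBootstrap) (hF : ∀ s : ℝ, s < 1 → ExponentFloor s) :
    ExponentFloor 1 := by
  intro ω₂ lam β γ hω hl hβ hγ T hT
  obtain ⟨C₁, N₀, h⟩ := hB ω₂ lam β γ hω hl hβ hγ T hT (fun s hs => hF s hs ω₂ lam β γ hω hl hβ hγ T hT)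
  exact ⟨C₁, N₀, fun N hN => by rw [Real.rpow_one]; exact h N hN⟩

/-- **NODE (two necessary pieces): `AsymptoticSeriesLaw ∧ SubOhmicBootstrap ⟹ 11071`.** [kernel · frame] -/
theorem boundedResponse_of_asymptoticSeriesLaw_of_subOhmicBootstrap (hA : AsymptoticSeriesLaw) (hB : SubOhmicBootstrap) :
    BoundedResponse :=
  exponentFloor_one_iff_boundedResponse.1
    (exponentFloor_one_of_subOhmicBootstrap hB fun _ hs => exponentFloor_of_asymptoticSeriesLaw hs hA)

/-- **`BufferedJunctionLaw ⟹ SubOhmicBootstrap`** (per temperature: the rung `s = 1/2` of the hypothesis makes `1/E_N` unbounded, so ONE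
good scale `1/E_{N⋆} ≥ C + 1` exists, and file 9's kernel `escapeFloor_one_of_bufferedJunctionAt_of_goodScale` gives the Ohmic floor). [kernel · frame] -/
theorem subOhmicBootstrap_of_bufferedJunctionLaw (hJ : JunctionDefectGrading.BufferedJunctionLaw) : SubOhmicBootstrap := by
  intro ω₂ lam β γ hω hl hβ hγ T hT hF
  obtain ⟨C, hC, L₀, N₂, hlaw⟩ := hJ ω₂ lam β γ hω hl hβ hγ T hT
  obtain ⟨C', N₀, hfl⟩ := hF (1 / 2) (by norm_num)
  have hpos : ∀ N : ℕ, 2 ≤ N → 0 < escapeDeficit ω₂ lam β γ T N := fun N hN =>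
    JunctionDefectGrading.escapeDeficit_pos hω hl hβ hγ hT hN
  -- a scale `N⋆ ≥ max (max N₂ 2) N₀` with `√N⋆ ≥ (C + 1)·max C' 1`
  obtain ⟨M, hM⟩ := exists_nat_ge (((C + 1) * max C' 1) ^ 2)
  set Ns : ℕ := max (max (max N₂ 2) N₀) (max M 1) with hNs
  have hNs2 : max N₂ 2 ≤ Ns := le_trans (le_max_left _ _) (le_max_left _ _)
  have hNs0 : N₀ ≤ Ns := le_trans (le_max_right _ _) (le_max_left _ _)
  have hNsM : ((C + 1) * max C' 1) ^ 2 ≤ (Ns : ℝ) :=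
    le_trans hM (by exact_mod_cast le_trans (le_max_left M 1) (le_max_right _ _))
  have hNs1 : 1 ≤ Ns := le_trans (le_max_right M 1) (le_max_right _ _)
  have hNspos : (0 : ℝ) < Ns := by exact_mod_cast hNs1
  have hE := hpos Ns (le_trans (le_max_right _ _) hNs2)
  have hC'1 : 0 < max C' 1 := lt_of_lt_of_le one_pos (le_max_right _ _)
  have hK : 0 < (C + 1) * max C' 1 := mul_pos (by linarith) hC'1
  -- `√Ns ≥ (C+1)·max C' 1`
  have hsqrt : (C + 1) * max C' 1 ≤ (Ns : ℝ) ^ (1 / 2 : ℝ) := by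
    rw [← Real.sqrt_eq_rpow]
    calc (C + 1) * max C' 1 = Real.sqrt (((C + 1) * max C' 1) ^ 2) := (Real.sqrt_sq hK.le).symm
      _ ≤ Real.sqrt Ns := Real.sqrt_le_sqrt hNsM
  -- `E_{N⋆} ≤ max C' 1/√N⋆ ≤ 1/(C+1)`, i.e. `C + 1 ≤ 1/E_{N⋆}`
  have hENs : escapeDeficit ω₂ lam β γ T Ns ≤ max C' 1 / (Ns : ℝ) ^ (1 / 2 : ℝ) :=
    le_trans (hfl Ns hNs0) (div_le_div_of_nonneg_right (le_max_left _ _) (Real.rpow_pos_of_pos hNspos _).le)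
  have hgood : C + 1 ≤ 1 / escapeDeficit ω₂ lam β γ T Ns := by
    rw [le_div_iff₀ hE]
    have hsq : 0 < (Ns : ℝ) ^ (1 / 2 : ℝ) := Real.rpow_pos_of_pos hNspos _
    have h1 : (C + 1) * escapeDeficit ω₂ lam β γ T Ns ≤ (C + 1) * (max C' 1 / (Ns : ℝ) ^ (1 / 2 : ℝ)) :=
      mul_le_mul_of_nonneg_left hENs (by linarith)
    have h2 : (C + 1) * (max C' 1 / (Ns : ℝ) ^ (1 / 2 : ℝ)) ≤ 1 := by
      rw [← mul_div_assoc, div_le_one hsq]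
      exact hsqrt
    linarith
  exact escapeFloor_one_of_bufferedJunctionAt_of_goodScale hω hl hβ hγ hT one_pos hlaw hNs2 hgood

/-- **`NoAnomalousChannel` (28285) ⟹ `SubOhmicBootstrap`**: along the canonical steady-state family, the rung `s = 1/2` of the hypothesis
gives `E_N → 0`, hence `D_N/N → 0`; 28285 bounds `|D_N|`, and `E_N = D_N/((N−1)γ) ≤ 2M/(γN)`. [folklore] -/
theorem subOhmicBootstrap_of_noAnomalousChannel (hA : NoAnomalousChannel) : SubOhmicBootstrap := by
  intro ω₂ lam β γ hω hl hβ hγ T hT hF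
  obtain ⟨μ, hμ, D, hD, hDE⟩ := JunctionDefectGrading.exists_canonical_response hω hl hβ hγ hT
  have huniq := bondHeatUncertainty_nessUnique_holds ω₂ lam β γ hω hl hβ hγ
  -- `E_N → 0` from the rung `s = 1/2`
  obtain ⟨C', N₀, hfl⟩ := hF (1 / 2) (by norm_num)
  have hE0 : ∀ N : ℕ, 2 ≤ N → 0 ≤ escapeDeficit ω₂ lam β γ T N := fun N hN => escapeDeficit_nonneg' hω hl hβ hγ hT hN
  have hvan : Tendsto (fun N : ℕ => escapeDeficit ω₂ lam β γ T N) atTop (𝓝 0) := by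
    have hpow : Tendsto (fun N : ℕ => ((N : ℝ)) ^ (1 / 2 : ℝ)) atTop atTop :=
      (tendsto_rpow_atTop (by norm_num)).comp tendsto_natCast_atTop_atTop
    have hg : Tendsto (fun N : ℕ => max C' 0 / ((N : ℝ)) ^ (1 / 2 : ℝ)) atTop (𝓝 0) := tendsto_const_nhds.div_atTop hpow
    refine squeeze_zero' ?_ ?_ hg
    · filter_upwards [eventually_ge_atTop 2] with N hN using hE0 N hN
    · filter_upwards [eventually_ge_atTop (max N₀ 1)] with N hN
      have hNpos : (0 : ℝ) < N := by exact_mod_cast lt_of_lt_of_le zero_lt_one (le_trans (le_max_right _ _) hN)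
      exact le_trans (hfl N (le_trans (le_max_left _ _) hN))
        (div_le_div_of_nonneg_right (le_max_left C' 0) (Real.rpow_pos_of_pos hNpos _).le)
  have hsub : Tendsto (fun N : ℕ => D N / (N : ℝ)) atTop (𝓝 0) :=
    tendsto_response_div_zero_of_escape (E := fun N => escapeDeficit ω₂ lam β γ T N) hγ hE0 hDE hvan
  have hbdd := hA ω₂ lam β γ hω hl hβ hγ huniq μ hμ T hT D hD hsub
  obtain ⟨M, hM⟩ := hbdd
  refine ⟨2 * M / γ, 2, fun N hN => ?_⟩
  have hNpos : (0 : ℝ) < N := by exact_mod_cast lt_of_lt_of_le (by norm_num) hN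
  have hN2 : (2 : ℝ) ≤ N := by exact_mod_cast hN
  have hDN : D N ≤ M := le_trans (le_abs_self _) (hM ⟨N, rfl⟩)
  rw [hDE N (by omega)] at hDN
  have hE := hE0 N hN
  rw [le_div_iff₀ hNpos, le_div_iff₀ hγ]
  nlinarith [mul_nonneg hγ.le hE, mul_nonneg (mul_nonneg (sub_nonneg.2 hN2) hγ.le) hE]

/-! ## E. The nodes: a necessary ratio law discharges the floor partner of the junction mechanism -/

/-- **NODE: `R(ρ) ∧ BufferedJunctionLaw ⟹ 11071` for ANY single `ρ > 1/2`** (a necessary rung as the floor partner of file 5's mechanism: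
`R(ρ)` gives `F(s)`, `s > 0`, and `boundedResponse_of_bufferedJunctionLaw_of_exponentFloor`). [kernel · frame] -/
theorem boundedResponse_of_seriesRatioLaw_of_bufferedJunctionLaw {ρ : ℝ} (hρ : 1 / 2 < ρ) (hR : SeriesRatioLaw ρ)
    (hJ : JunctionDefectGrading.BufferedJunctionLaw) : BoundedResponse := by
  obtain ⟨s, hs, hs1, hF⟩ := exponentFloor_pos_of_seriesRatioLaw hρ hR
  exact JunctionDefectGrading.boundedResponse_of_bufferedJunctionLaw_of_exponentFloor hs hs1 hJ hF

/-- **NODE: `AsymptoticSeriesLaw ∧ BufferedJunctionLaw ⟹ 11071`** — relative law (NECESSARY) + absolute law (mechanism). [kernel · frame] -/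
theorem boundedResponse_of_asymptoticSeriesLaw_of_bufferedJunctionLaw (hA : AsymptoticSeriesLaw)
    (hJ : JunctionDefectGrading.BufferedJunctionLaw) : BoundedResponse :=
  boundedResponse_of_seriesRatioLaw_of_bufferedJunctionLaw (by norm_num : (1 : ℝ) / 2 < 3 / 4) (hA _ (by norm_num)) hJ

/-- **NODE: `AsymptoticSeriesLaw ∧ LocalityPassivityLaw ⟹ 11071`** (file 5's profile-level supplier of the junction law). [kernel · frame] -/
theorem boundedResponse_of_asymptoticSeriesLaw_of_localityPassivityLaw (hA : AsymptoticSeriesLaw)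
    (hL : JunctionDefectGrading.LocalityPassivityLaw) : BoundedResponse :=
  boundedResponse_of_asymptoticSeriesLaw_of_bufferedJunctionLaw hA (JunctionDefectGrading.bufferedJunctionLaw_of_localityPassivityLaw hL)

/-- **GRADED NODE: `R(ρ) ∧ BufferedJunctionLawPow θ ⟹ 11071` whenever `2^θ < 2ρ`, `0 ≤ θ < 1`** (a necessary rung with more slack pays for
a junction law with a growing defect `C·N^θ`: pick `s ∈ (θ, 1]` with `2^s ≤ 2ρ`). [kernel · frame] -/
theorem boundedResponse_of_seriesRatioLaw_of_bufferedJunctionLawPow {ρ θ : ℝ} (hθ0 : 0 ≤ θ) (hθ1 : θ < 1)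
    (hρθ : (2 : ℝ) ^ θ < 2 * ρ) (hR : SeriesRatioLaw ρ) (hB : BufferedJunctionLawPow θ) : BoundedResponse := by
  -- `s := min 1 (logb 2 (2ρ)) > θ`
  have h2ρ : 0 < 2 * ρ := lt_of_le_of_lt (Real.rpow_pos_of_pos two_pos θ).le hρθ
  have hθL : θ < Real.logb 2 (2 * ρ) := by
    rw [Real.lt_logb_iff_rpow_lt (by norm_num) h2ρ]
    exact hρθ
  have hs : θ < min 1 (Real.logb 2 (2 * ρ)) := lt_min hθ1 hθL
  refine boundedResponse_of_bufferedJunctionLawPow_of_exponentFloor hθ0 hθ1 hs hB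
    (exponentFloor_of_seriesRatioLaw (hθ0.trans hs.le) ?_ hR)
  calc (2 : ℝ) ^ min 1 (Real.logb 2 (2 * ρ)) ≤ (2 : ℝ) ^ Real.logb 2 (2 * ρ) :=
        Real.rpow_le_rpow_of_exponent_le (by norm_num) (min_le_right _ _)
    _ = 2 * ρ := Real.rpow_logb (by norm_num) (by norm_num) h2ρ

/-- **GRADED NODE with a NECESSARY partner: `AsymptoticSeriesLaw ∧ BufferedJunctionLawPow θ ⟹ 11071` for EVERY `0 ≤ θ < 1`** — the
junction side may carry a defect growing like `C·N^θ`, any `θ < 1`, once the floor partner is the necessary ratio law (`ρ := 1/2 + 2^θ/4`).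
[kernel · frame] -/
theorem boundedResponse_of_asymptoticSeriesLaw_of_bufferedJunctionLawPow {θ : ℝ} (hθ0 : 0 ≤ θ) (hθ1 : θ < 1)
    (hA : AsymptoticSeriesLaw) (hB : BufferedJunctionLawPow θ) : BoundedResponse := by
  have h2θ : (2 : ℝ) ^ θ < 2 := by
    have h := Real.rpow_lt_rpow_of_exponent_lt (by norm_num : (1 : ℝ) < 2) hθ1
    rwa [Real.rpow_one] at h
  exact boundedResponse_of_seriesRatioLaw_of_bufferedJunctionLawPow (ρ := 1 / 2 + (2 : ℝ) ^ θ / 4) hθ0 hθ1 (by linarith)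
    (hA _ (by linarith)) hB

/-- **`AsymptoticSeriesLaw ∧ JunctionLaw θ ⟹ 11071`** (`0 ≤ θ < 1`; file (2)'s exact-junction law via file (11)'s
`bufferedJunctionLawPow_of_junctionLaw`). [kernel · frame] -/
theorem boundedResponse_of_asymptoticSeriesLaw_of_junctionLaw {θ : ℝ} (hθ0 : 0 ≤ θ) (hθ1 : θ < 1) (hA : AsymptoticSeriesLaw)
    (hJ : JunctionDefectGrading.JunctionLaw θ) : BoundedResponse :=
  boundedResponse_of_asymptoticSeriesLaw_of_bufferedJunctionLawPow hθ0 hθ1 hA (bufferedJunctionLawPow_of_junctionLaw hJ)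

/-- The three edges out of the conjunct and the blocker, for the docket: `FouriersLaw ⟹ R(1⁻)`, `11071 ⟹ SubOhmicBootstrap`,
`R(1⁻) ∧ SubOhmicBootstrap ⟹ 11071` — both pieces are implied by the conjunct (`fouriersLaw_of_boundedResponse`-free direction only). [folklore] -/
theorem pieces_of_fouriersLaw (hF : _root_.FouriersLaw) (hB : BoundedResponse) : AsymptoticSeriesLaw ∧ SubOhmicBootstrap :=
  ⟨asymptoticSeriesLaw_of_fouriersLaw hF, subOhmicBootstrap_of_boundedResponse hB⟩

end EscapeGrading

end Summit.AtomisticToContinuum.FouriersLaw.Theorems.SubdiffusiveBondHeat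

end
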